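import Literature.NumberTheory.EllipticCurves.ModularParamFormalDictionaryProofs
import Literature.NumberTheory.EllipticCurves.PeriodLatticeRationalityLemmasProofs
import Literature.NumberTheory.EllipticCurves.ModularParamXRationality
import Literature.NumberTheory.EllipticCurves.DeligneSerreProp27LevelDescentProofs
import Mathlib.RingTheory.Localization.Integer
import HarnessLib

/-!
# The `X₁(N)`-parametrisation in formal terms: `log_E(z) = Σ aₙqⁿ/n` with `z`, `w_E(z) ∈ ℚ⟦q⟧ ∩ Frac ℤ⟦q⟧`
# from a RATIONAL `Γ₁(N)`-presentation (route `ManinLocalTwoThree`, cruxes C2 stmt-BirchSwinnertonDyer-22967 /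
# C3 stmt-…-22968; cell bsd-f2-manin, prover p2 gen 25; CES-discharge programme, stage 3 step (1))

The tree's Edixhoven formal-group programme (`NeronIsogenyScaling.lean`, fact
`edixhoven_int_of_neronLattice_eq_smul_periodLattice`, PROVED) reads the `X₀(N)`-parametrisation of `ℂ/Λ₀(f)` as a
formal series: `EichlerShimuraCongruenceHondaProofs.exists_rat_series_formalLog_subst_eq` and
`ModularParamFormalDictionaryProofs.exists_rat_series_formalLog_subst_eq_formalW` give `z ∈ qℚ⟦q⟧` with
`log_E(z) = Σ aₙqⁿ/n`, `z·Q = P`, `w_E(z)·Q₂ = P₂` (`P, Q, P₂, Q₂ ∈ ℤ⟦q⟧`, `Q, Q₂ ≠ 0`) for the short model `E` of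
`ℂ/Λ`, `Λ ⊇ Λ₀(f)`, from a presentation of `℘_Λ(ℰ_f)` by cusp forms on `Γ₀(N)` and Shimura's integral basis of
`S_k(Γ₀(N))`.  THIS FILE proves the same conclusion from a RATIONAL presentation by cusp forms on `Γ₁(N)`:

* `exists_rat_series_formalLog_subst_eq_formalW_of_gamma1_presentation` — for `f ∈ S₂(Γ₀(N))`, `f ≠ 0` with integral
  coefficients `aₙ`, a period pair `L` with `g₂(L) = −4a₄`, `g₃(L) = −4a₆` (`a₄, a₆ ∈ ℚ`), and cusp forms
  `F, G ∈ S_k(Γ₁(N))`, `k ≥ 1`, `G ≠ 0`, with RATIONAL Fourier coefficients and `℘_L(ℰ_f)·G = F` off the poles: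
  there is `z ∈ qℚ⟦q⟧` with `log_E(z) = Σ aₙqⁿ/n` for `E : y² = x³ + a₄x + a₆` and `z·Q = P`, `w_E(z)·Q₂ = P₂` with
  `P, Q, P₂, Q₂ ∈ ℤ⟦q⟧`, `Q, Q₂ ≠ 0`.

Proof: the cleared Weierstrass equation `(bθa − aθb)² = 4e²b(a³ + a₄ab² + a₆b³)` for the expansions `a, b, e` of
`F, G, f` is the tree's `odeFun_eq_zero_of_presentation` / `odeFun_eq_zero_iff` (stated for `Γ₁(N)`-forms), `ord a < ord b`
because `|℘_L(ℰ_f)| → ∞` at the cusp, the series `z` with `z·(bθa − aθb) = −2abe` is `exists_mul_wronskian_eq`, and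
`log_E(z) = Σ aₙqⁿ/n`, `a·w_E(z) = b·z` are the tree's abstract `formalLog_subst_eq_of_ode` / `formalW_subst_eq_of_ode`.
Bounded denominators of `a, b` are Deligne–Serre (2.7.2) for `Γ₁(N)` (tree theorem
`Literature.NumberTheory.ModularForms.exists_int_mul_isIntegral_cuspCoeff`, `K = ℚ`), whence `Q = D₁D₂(bθa − aθb)`,
`P = −2D₁D₂abe`, `Q₂ = D₂·(D₁a)·Q`, `P₂ = D₁·(D₂b)·P` are integral and `z = P/Q` is rational.

This is the `Γ₁(N)`-input of the Stevens-curve port of Edixhoven's integrality (Conrad–Edixhoven–Stein 2003, Lemma 6.1.6: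
the Manin constant of the `X₁(N)`-optimal curve is an integer), towards the named fact
`exists_optimal_gamma1ParametrizationData` (CES).  Fact-free; standard axioms; no definitions.  BSD is not proved by
this file; Manin's conjecture, C2 and C3 are not proved by this file.
[cite: Honda1970, §6.2 (pp. 241–242)] [cite: ConradEdixhovenStein2003, §6.1, Lemma 6.1.6] [cite: Stevens1989, §2]
[cite: DeligneSerreASENS1974, Prop. 2.7 (2.7.2), Rem. 2.8] [cite: SilvermanAEC2009, IV.1.1]
-/

set_option autoImplicit false
-- lint-debt: the directory name repeats the summit name (sibling precedent `ManinLocalTwoThreeStevensCurveDatum.lean`)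
set_option linter.dupNamespace false

noncomputable section

open Complex Filter Topology Set Function PowerSeries
open UpperHalfPlane hiding I
open scoped Real Topology Manifold MatrixGroups PeriodPair ModularForm
open ModularForm CongruenceSubgroup
open Literature.NumberTheory.EllipticCurves Literature.NumberTheory.EllipticCurves.ModularForms

namespace Summit.BirchSwinnertonDyer.BirchSwinnertonDyer.Theorems.ManinLocalTwoThree.StevensIntegrality

variable {N : ℕ} [NeZero N] {k : ℤ}

/-! ## §1 Elementary series lemmas -/

/-- A cusp form on `Γ₁(N)` with nonzero underlying function has nonzero `q`-expansion (`q`-expansion principle,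
`cuspForm_gamma1_eq_zero_of_forall_cuspCoeff`). [folklore] -/
theorem qExpansion_ne_zero_of_ne_zero_gamma1 {G : CuspForm (Gamma1 N) k} (hG : G ≠ 0) :
    qExpansion 1 (⇑G) ≠ 0 := by
  intro h0
  exact hG (cuspForm_gamma1_eq_zero_of_forall_cuspCoeff G fun n ↦ by
    change (qExpansion 1 ⇑G).coeff n = 0
    rw [h0, map_zero])

/-- A `ℚ`-linear retraction `ρ : ℂ → ℚ` of the inclusion (`ℂ` is a `ℚ`-vector space). [folklore] -/
theorem exists_rat_linear_retraction : ∃ ρ : ℂ →ₗ[ℚ] ℚ, ∀ x : ℚ, ρ (x : ℂ) = x := by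
  have hinj : LinearMap.ker (Algebra.linearMap ℚ ℂ) = ⊥ := by
    rw [LinearMap.ker_eq_bot]
    exact (algebraMap ℚ ℂ).injective
  obtain ⟨ρ, hρ⟩ := LinearMap.exists_leftInverse_of_injective (Algebra.linearMap ℚ ℂ) hinj
  exact ⟨ρ, fun x ↦ congrArg (fun f ↦ f x) hρ⟩

/-- **Bounded denominators of a rational cusp form on `Γ₁(N)`** (Deligne–Serre 1974, (2.7.2) and Rem. 2.8): if
`F ∈ S_k(Γ₁(N))`, `k ≥ 1`, has rational Fourier coefficients, then `D·(q-expansion of F) ∈ ℤ⟦q⟧` for some integer `D ≠ 0`.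
Proof: `F = Σ cᵢhᵢ` over the Deligne–Serre integral spanning set `L` (tree theorem `DeligneSerre1974_span_integralLattice1_holds`);
a `ℚ`-linear retraction `ℂ → ℚ` applied coefficientwise makes the `cᵢ` rational, and finitely many rationals have a
common denominator. [cite: DeligneSerreASENS1974, Prop. 2.7 (2.7.2), Rem. 2.8] -/
theorem exists_intSeries_of_rat_cuspCoeff_gamma1 (hk : 1 ≤ k) (F : CuspForm (Gamma1 N) k)
    (hFr : ∀ n, ∃ q : ℚ, (q : ℂ) = cuspCoeff F n) :
    ∃ (D : ℤ) (A : ℤ⟦X⟧), D ≠ 0 ∧ A.map (Int.castRingHom ℂ) = C (D : ℂ) * qExpansion 1 (⇑F) := by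
  classical
  have hspan := DeligneSerre1974_span_integralLattice1_holds N k hk
  have hFmem : F ∈ Submodule.span ℂ (integralLattice1 N k : Set (CuspForm (Gamma1 N) k)) := by
    rw [hspan]; exact Submodule.mem_top
  obtain ⟨m, c, h, hsum⟩ := Submodule.mem_span_set'.mp hFmem
  have hz' : ∀ (i : Fin m) (n : ℕ), ∃ z : ℤ, (z : ℂ) = cuspCoeff (h i).1 n :=
    fun i n ↦ exists_int_eq_cuspCoeff_of_mem_integralLattice1 (h i).2 n
  choose z hz using hz'
  -- coefficientwise: `aₙ(F) = ∑ cᵢ aₙ(hᵢ)`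
  have hcoef : ∀ n, cuspCoeff F n = ∑ i, c i * (z i n : ℂ) := by
    intro n
    have := congrArg (cuspCoeffₗ (k := k) (HeckeTGamma1.one_mem_strictPeriods_Gamma1 N) n) hsum
    rw [map_sum] at this
    simp only [map_smul, smul_eq_mul] at this
    change _ = cuspCoeff F n at this
    rw [← this]
    refine Finset.sum_congr rfl fun i _ ↦ ?_
    rw [hz]
    rfl
  -- descend the coordinates to `ℚ`
  obtain ⟨ρ, hρ⟩ := exists_rat_linear_retraction
  choose q hq using hFr
  have hcoefQ : ∀ n, q n = ∑ i, ρ (c i) * (z i n : ℚ) := by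
    intro n
    have h1 : q n = ρ (cuspCoeff F n) := by rw [← hq n, hρ]
    rw [h1, hcoef n, map_sum]
    refine Finset.sum_congr rfl fun i _ ↦ ?_
    have h2 : c i * (z i n : ℂ) = ((z i n : ℚ) : ℚ) • c i := by
      rw [Rat.smul_def, mul_comm]; push_cast; rfl
    rw [h2, map_smul, smul_eq_mul, mul_comm]
  -- clear denominators
  obtain ⟨⟨b, hb⟩, hbint⟩ :=
    IsLocalization.exist_integer_multiples (nonZeroDivisors ℤ) (Finset.univ : Finset (Fin m)) fun i ↦ ρ (c i)
  have hb0 : b ≠ 0 := nonZeroDivisors.ne_zero hb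
  have hmi : ∀ i, ∃ mi : ℤ, (mi : ℚ) = (b : ℚ) * ρ (c i) := fun i ↦ by
    obtain ⟨mi, hmi⟩ := hbint i (Finset.mem_univ i)
    exact ⟨mi, by simpa [zsmul_eq_mul] using hmi⟩
  choose mi hmi' using hmi
  refine ⟨b, PowerSeries.mk fun n ↦ ∑ i, mi i * z i n, hb0, ?_⟩
  ext n
  rw [coeff_map, coeff_mk, coeff_C_mul]
  change (Int.castRingHom ℂ) (∑ i, mi i * z i n) = (b : ℂ) * cuspCoeff F n
  rw [← hq n, hcoefQ n, map_sum]
  push_cast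
  rw [Finset.mul_sum]
  refine Finset.sum_congr rfl fun i _ ↦ ?_
  rw [map_mul, eq_intCast, eq_intCast]
  have h3 : ((mi i : ℚ) : ℂ) = (((b : ℚ) * ρ (c i) : ℚ) : ℂ) := by rw [hmi' i]
  push_cast at h3
  rw [h3]
  ring

/-- If `z ∈ ℂ⟦X⟧` satisfies `z·Q = P` with `P, Q ∈ ℤ⟦X⟧`, `Q ≠ 0`, then `z` has rational coefficients. [folklore] -/
theorem exists_ratSeries_map_eq_of_mul_eq {z : ℂ⟦X⟧} {P Q : ℤ⟦X⟧} (hQ : Q ≠ 0)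
    (h : z * Q.map (Int.castRingHom ℂ) = P.map (Int.castRingHom ℂ)) :
    ∃ zq : ℚ⟦X⟧, zq.map (algebraMap ℚ ℂ) = z := by
  set Qq : ℚ⟦X⟧ := Q.map (Int.castRingHom ℚ) with hQq
  set Pq : ℚ⟦X⟧ := P.map (Int.castRingHom ℚ) with hPq
  have hmm : ∀ φ : ℤ⟦X⟧, (φ.map (Int.castRingHom ℚ)).map (algebraMap ℚ ℂ) = φ.map (Int.castRingHom ℂ) := by
    intro φ; ext n; simp [coeff_map]
  have hQq0 : Qq ≠ 0 := by
    intro h0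
    apply hQ
    ext n
    have := congrArg (coeff n) h0
    rw [hQq, coeff_map, map_zero, eq_intCast, Int.cast_eq_zero] at this
    rw [this, map_zero]
  -- `Qq = X^m · Q₀`, `Q₀(0) ≠ 0`
  set m := Qq.order.toNat with hm
  set Q₀ := divXPowOrder Qq with hQ₀
  have hQ₀0 : constantCoeff Q₀ ≠ 0 := fun h0 ↦ hQq0 (constantCoeff_divXPowOrder_eq_zero_iff.mp h0)
  have hQfac : Qq = PowerSeries.X ^ m * Q₀ := X_pow_order_mul_divXPowOrder.symm
  -- over `ℂ`: `z · X^m · Q₀ = P`, so `X^m · z = P · Q₀⁻¹`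
  set Q₀c := Q₀.map (algebraMap ℚ ℂ) with hQ₀c
  have hQ₀c0 : constantCoeff Q₀c ≠ 0 := by
    rw [hQ₀c, ← coeff_zero_eq_constantCoeff, coeff_map, coeff_zero_eq_constantCoeff]
    exact fun h0 ↦ hQ₀0 ((map_eq_zero (algebraMap ℚ ℂ)).mp h0)
  have hXm : (PowerSeries.X : ℂ⟦X⟧) ^ m * Q₀c = (PowerSeries.X ^ m * Q₀).map (algebraMap ℚ ℂ) := by
    rw [map_mul, map_pow, PowerSeries.map_X]
  have h1 : z * (PowerSeries.X ^ m * Q₀c) = Pq.map (algebraMap ℚ ℂ) := by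
    rw [hXm, ← hQfac, hQq, hPq, hmm, hmm]
    exact h
  set R : ℚ⟦X⟧ := Pq * Q₀⁻¹ with hR
  have hRQ : R * Q₀ = Pq := by rw [hR, mul_assoc, PowerSeries.inv_mul_cancel _ hQ₀0, mul_one]
  have hQ₀c0' : Q₀c ≠ 0 := fun h0 ↦ hQ₀c0 (by rw [h0, map_zero])
  have hzc : PowerSeries.X ^ m * z = R.map (algebraMap ℚ ℂ) := by
    apply mul_right_cancel₀ hQ₀c0'
    rw [show R.map (algebraMap ℚ ℂ) * Q₀c = Pq.map (algebraMap ℚ ℂ) by rw [hQ₀c, ← map_mul, hRQ], ← h1]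
    ring
  refine ⟨PowerSeries.mk fun n ↦ coeff (n + m) R, ?_⟩
  ext n
  rw [coeff_map, coeff_mk, ← coeff_map (algebraMap ℚ ℂ), ← hzc, coeff_X_pow_mul']
  simp

/-! ## §2 A `Γ₁(N)`-presentation: the numerator is nonzero and the cusp order of `F/G` is negative -/

/-- **`F ≠ 0`** for a presentation `℘_L(ℰ_f)·G = F`, `G ≠ 0`: near the cusp `G ≠ 0`, `ℰ_f ∉ Λ(L)` and `|℘_L(ℰ_f)| → ∞`.
[folklore] -/
theorem numerator_ne_zero_gamma1 (f : CuspForm (Gamma0 N) 2) (hf : f ≠ 0) (L : PeriodPair)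
    (F G : CuspForm (Gamma1 N) k) (hG : G ≠ 0)
    (hFG : ∀ τ : ℍ, eichlerIntegral f τ ∉ L.lattice → ℘[L] (eichlerIntegral f τ) * G τ = F τ) :
    F ≠ 0 := by
  intro hF
  have hG1 := isCuspFunction_one_gamma1 G
  have hG0 := qExpansion_ne_zero_of_ne_zero_gamma1 hG
  have hGev : ∀ᶠ τ : ℍ in atImInfty, G τ ≠ 0 :=
    eventually_ne_zero_atImInfty hG1.periodic hG1.mdifferentiable hG1.isBoundedAtImInfty hG0
  obtain ⟨T, hT⟩ := exists_forall_eichlerIntegral_smul_notMem f hf L 1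
  have hT' : ∀ᶠ τ : ℍ in atImInfty, eichlerIntegral f τ ∉ L.lattice := by
    rw [atImInfty, Filter.eventually_comap]
    filter_upwards [Filter.eventually_ge_atTop T] with t ht τ hτ
    have := hT τ (by rw [← hτ] at ht; exact ht)
    rwa [one_smul] at this
  have hbig : ∀ᶠ τ : ℍ in atImInfty, 1 ≤ ‖℘[L] (eichlerIntegral f τ)‖ :=
    (tendsto_norm_weierstrassP_eichlerIntegral_atTop f hf L).eventually (eventually_ge_atTop 1)
  obtain ⟨τ, hGτ, hτ, h1⟩ := (hGev.and (hT'.and hbig)).exists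
  have h := hFG τ hτ
  rw [hF] at h
  have h0 : ℘[L] (eichlerIntegral f τ) * G τ = 0 := h
  rcases mul_eq_zero.mp h0 with h2 | h2
  · rw [h2, norm_zero] at h1
    exact absurd h1 (by norm_num)
  · exact hGτ h2

/-- **`ord_∞(F) < ord_∞(G)`** for a presentation `℘_L(ℰ_f)·G = F` on `Γ₁(N)`: `x = F/G = ℘_L(ℰ_f)` blows up at the cusp
(port of the tree's `IsXPresentation.qOrder_lt` from `Γ₀(N)` to `Γ₁(N)`). [folklore] -/
theorem order_lt_of_gamma1_presentation (f : CuspForm (Gamma0 N) 2) (hf : f ≠ 0) (L : PeriodPair)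
    (F G : CuspForm (Gamma1 N) k) (hG : G ≠ 0)
    (hFG : ∀ τ : ℍ, eichlerIntegral f τ ∉ L.lattice → ℘[L] (eichlerIntegral f τ) * G τ = F τ) :
    (qExpansion 1 (⇑F)).order.toNat < (qExpansion 1 (⇑G)).order.toNat := by
  by_contra hle
  rw [not_lt] at hle
  have hF1 := isCuspFunction_one_gamma1 F
  have hG1 := isCuspFunction_one_gamma1 G
  have hF0 := qExpansion_ne_zero_of_ne_zero_gamma1 (numerator_ne_zero_gamma1 f hf L F G hG hFG)
  have hG0 := qExpansion_ne_zero_of_ne_zero_gamma1 hG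
  obtain ⟨c, hc⟩ := exists_tendsto_div_of_order_le hF1.periodic hF1.mdifferentiable hF1.isBoundedAtImInfty hF0
    hG1.periodic hG1.mdifferentiable hG1.isBoundedAtImInfty hG0 hle
  obtain ⟨T, hT⟩ := exists_forall_eichlerIntegral_smul_notMem f hf L 1
  have hev : ∀ᶠ τ : ℍ in atImInfty, F τ / G τ = ℘[L] (eichlerIntegral f τ) := by
    have hGev : ∀ᶠ τ : ℍ in atImInfty, G τ ≠ 0 :=
      eventually_ne_zero_atImInfty hG1.periodic hG1.mdifferentiable hG1.isBoundedAtImInfty hG0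
    have hT' : ∀ᶠ τ : ℍ in atImInfty, eichlerIntegral f τ ∉ L.lattice := by
      rw [atImInfty, Filter.eventually_comap]
      filter_upwards [Filter.eventually_ge_atTop T] with t ht τ hτ
      have := hT τ (by rw [← hτ] at ht; exact ht)
      rwa [one_smul] at this
    filter_upwards [hGev, hT'] with τ hGτ hτ
    rw [div_eq_iff hGτ, hFG τ hτ]
  have hlim : Tendsto (fun τ : ℍ ↦ ℘[L] (eichlerIntegral f τ)) atImInfty (𝓝 c) := hc.congr' hev
  exact not_tendsto_of_tendsto_norm_atTop hlim (tendsto_norm_weierstrassP_eichlerIntegral_atTop f hf L)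

/-! ## §3 The formal series of the `X₁(N)`-parametrisation -/

/-- **The `X₁(N)`-parametrisation at `∞` in formal terms, with bounded denominators.**  Let `f ∈ S₂(Γ₀(N))`,
`f ≠ 0`, have integral Fourier coefficients `aₙ`, let `L` be a period pair with `g₂(L) = −4a₄`, `g₃(L) = −4a₆`
(`a₄, a₆ ∈ ℚ`), and let `F, G ∈ S_k(Γ₁(N))` (`k ≥ 1`, `G ≠ 0`) have RATIONAL Fourier coefficients and present
`x = ℘_L(ℰ_f)`: `℘_L(ℰ_f τ)·G(τ) = F(τ)` off the poles.  Then there is `z ∈ qℚ⟦q⟧` — the `q`-expansion of the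
local parameter `−X/Y` of `E : Y² = X³ + a₄X + a₆` along `τ ↦ (℘_L(ℰ_f τ), ℘_L'(ℰ_f τ)/2)` — with
`log_E(z) = Σ aₙqⁿ/n`, and `P, Q, P₂, Q₂ ∈ ℤ⟦q⟧`, `Q, Q₂ ≠ 0`, with `z·Q = P` and `w_E(z)·Q₂ = P₂` (`w_E = formalW`).
For `L` with `Λ(L) ⊇ Λ₁(f)` such `F, G` exist (p3's `StevensCurve.exists_rat_gamma1_presentation_of_gamma1Datum_one`);
this is the `Γ₁(N)`-twin of the tree's `exists_rat_series_formalLog_subst_eq_formalW` (there: `Γ₀(N)`, Shimura Thm. 3.52;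
here: Deligne–Serre (2.7.2)). [cite: Honda1970, §6.2 (pp. 241–242)] [cite: ConradEdixhovenStein2003, Lemma 6.1.6]
[cite: DeligneSerreASENS1974, Prop. 2.7 (2.7.2), Rem. 2.8] [cite: SilvermanAEC2009, IV.1.1] -/
theorem exists_rat_series_formalLog_subst_eq_formalW_of_gamma1_presentation
    (f : CuspForm (Gamma0 N) 2) (hf : f ≠ 0) (a : ℕ → ℤ) (ha : ∀ n, (a n : ℂ) = cuspCoeff f n)
    (L : PeriodPair) (a₄ a₆ : ℚ) (h₂ : L.g₂ = -4 * (a₄ : ℂ)) (h₃ : L.g₃ = -4 * (a₆ : ℂ))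
    (hk : 1 ≤ k) (F G : CuspForm (Gamma1 N) k) (hG : G ≠ 0)
    (hFG : ∀ τ : ℍ, eichlerIntegral f τ ∉ L.lattice → ℘[L] (eichlerIntegral f τ) * G τ = F τ)
    (hFr : ∀ n, ∃ q : ℚ, (q : ℂ) = cuspCoeff F n) (hGr : ∀ n, ∃ q : ℚ, (q : ℂ) = cuspCoeff G n) :
    ∃ (z : ℚ⟦X⟧) (P Q P₂ Q₂ : ℤ⟦X⟧), constantCoeff z = 0 ∧ Q ≠ 0 ∧
      z * Q.map (Int.castRingHom ℚ) = P.map (Int.castRingHom ℚ) ∧ Q₂ ≠ 0 ∧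
      ({ a₁ := 0, a₂ := 0, a₃ := 0, a₄ := a₄, a₆ := a₆ } : WeierstrassCurve ℚ).formalW.subst z *
          Q₂.map (Int.castRingHom ℚ) = P₂.map (Int.castRingHom ℚ) ∧
      ({ a₁ := 0, a₂ := 0, a₃ := 0, a₄ := a₄, a₆ := a₆ } : WeierstrassCurve ℚ).formalLog.subst z =
        PowerSeries.mk fun n ↦ (a n : ℚ) / n := by
  classical
  set Wc : WeierstrassCurve ℂ := { a₁ := 0, a₂ := 0, a₃ := 0, a₄ := (a₄ : ℂ), a₆ := (a₆ : ℂ) } with hWc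
  set Wq : WeierstrassCurve ℚ := { a₁ := 0, a₂ := 0, a₃ := 0, a₄ := a₄, a₆ := a₆ } with hWq
  have hmapW : Wq.map (algebraMap ℚ ℂ) = Wc := by simp [hWq, hWc, WeierstrassCurve.map]
  -- the expansions
  set aC := qExpansion 1 (⇑F) with haC
  set bC := qExpansion 1 (⇑G) with hbC
  set eC := qExpansion 1 (⇑f) with heC
  have hF0 : F ≠ 0 := numerator_ne_zero_gamma1 f hf L F G hG hFG
  have hf' : (f : ModularForm (Gamma0 N) 2) ≠ 0 := by
    intro h0; apply hf; apply DFunLike.ext; intro τ; exact DFunLike.congr_fun h0 τ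
  have ha0 : aC ≠ 0 := qExpansion_ne_zero_of_ne_zero_gamma1 hF0
  have hb0 : bC ≠ 0 := qExpansion_ne_zero_of_ne_zero_gamma1 hG
  have he0 : eC ≠ 0 := qExpansion_ne_zero_of_ne_zero hf'
  have hac : constantCoeff aC = 0 := by
    rw [← coeff_zero_eq_constantCoeff_apply, haC]
    exact CuspFormClass.qExpansion_coeff_zero F one_pos (HeckeTGamma1.one_mem_strictPeriods_Gamma1 N)
  have hec : constantCoeff eC = 0 := by
    rw [← coeff_zero_eq_constantCoeff_apply, heC]
    exact CuspFormClass.qExpansion_coeff_zero f one_pos (one_mem_strictPeriods_coe_gamma0 N)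
  have hord : aC.order.toNat < bC.order.toNat := order_lt_of_gamma1_presentation f hf L F G hG hFG
  -- the cleared Weierstrass equation on `q`-expansions
  have hode : (bC * thetaPS aC - aC * thetaPS bC) ^ 2 =
      4 * eC ^ 2 * bC * (aC ^ 3 + C (a₄ : ℂ) * aC * bC ^ 2 + C (a₆ : ℂ) * bC ^ 3) := by
    have h0 := (odeFun_eq_zero_iff f F G L.g₂ L.g₃).mp (odeFun_eq_zero_of_presentation f hf L F G hFG)
    rw [← thetaPS_def, ← thetaPS_def, h₂, h₃, map_mul, map_mul, map_neg, map_ofNat] at h0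
    rw [← haC, ← hbC, ← heC] at h0
    linear_combination h0
  -- the series `z` with `z·(bθa − aθb) = −2abe`, and the formal identities
  obtain ⟨zC, hz⟩ := exists_mul_wronskian_eq eC ha0 hb0 hord
  obtain ⟨hz0, hlog⟩ := formalLog_subst_eq_of_ode (a₄ : ℂ) (a₆ : ℂ) ha0 hb0 he0 hac hec hord hode hz
  have hw := formalW_subst_eq_of_ode (a₄ : ℂ) (a₆ : ℂ) ha0 hb0 he0 hac hec hord hode hz
  set Wr := bC * thetaPS aC - aC * thetaPS bC with hWr
  have htwo : (2 : ℂ⟦X⟧) ≠ 0 := by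
    intro h2
    have := congrArg constantCoeff h2
    rw [map_ofNat, map_zero] at this
    norm_num at this
  have hWr0 : Wr ≠ 0 := by
    intro h0
    rw [h0, mul_zero] at hz
    exact mul_ne_zero (mul_ne_zero (mul_ne_zero (neg_ne_zero.mpr htwo) ha0) hb0) he0 hz.symm
  -- integral models `A = D₁·a`, `B = D₂·b`, `Es = e`
  obtain ⟨D₁, A, hD₁, hA⟩ := exists_intSeries_of_rat_cuspCoeff_gamma1 hk F hFr
  obtain ⟨D₂, B, hD₂, hB⟩ := exists_intSeries_of_rat_cuspCoeff_gamma1 hk G hGr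
  rw [← haC] at hA
  rw [← hbC] at hB
  set Es : ℤ⟦X⟧ := PowerSeries.mk a with hEs
  have hEmap : Es.map (Int.castRingHom ℂ) = eC := by
    ext n; rw [coeff_map, hEs, coeff_mk, eq_intCast, ha n]; rfl
  set Q : ℤ⟦X⟧ := B * (PowerSeries.mk fun n ↦ (n : ℤ) * coeff n A) -
    A * (PowerSeries.mk fun n ↦ (n : ℤ) * coeff n B) with hQ
  set P : ℤ⟦X⟧ := -2 * A * B * Es with hP
  have hQmap : Q.map (Int.castRingHom ℂ) = C ((D₁ : ℂ) * D₂) * Wr := by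
    rw [hQ, map_sub, map_mul, map_mul, IsXPresentation.map_mk_mul_coeff_eq_thetaPS, IsXPresentation.map_mk_mul_coeff_eq_thetaPS, hA, hB,
      thetaPS_C_mul, thetaPS_C_mul, hWr, map_mul]
    ring
  have hPmap : P.map (Int.castRingHom ℂ) = C ((D₁ : ℂ) * D₂) * (-2 * aC * bC * eC) := by
    rw [hP, map_mul, map_mul, map_mul, hA, hB, hEmap, map_neg, map_ofNat, map_mul]
    ring
  have hzQ : zC * Q.map (Int.castRingHom ℂ) = P.map (Int.castRingHom ℂ) := by
    rw [hQmap, hPmap, mul_left_comm, hz]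
  have hD : ((D₁ : ℂ) * D₂) ≠ 0 := mul_ne_zero (by exact_mod_cast hD₁) (by exact_mod_cast hD₂)
  have hQ0 : Q ≠ 0 := by
    intro h0
    have : C ((D₁ : ℂ) * D₂) * Wr = 0 := by rw [← hQmap, h0, map_zero]
    rcases mul_eq_zero.mp this with h1 | h1
    · exact hD (by simpa using congrArg constantCoeff h1)
    · exact hWr0 h1
  -- the `w`-coordinate: `a·w = b·z`, hence `w·(D₂·A·Q) = D₁·B·P`
  set wC := Wc.formalW.subst zC with hwC
  have hA0 : A ≠ 0 := by
    intro h0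
    have : C (D₁ : ℂ) * aC = 0 := by rw [← hA, h0, map_zero]
    rcases mul_eq_zero.mp this with h1 | h1
    · exact (show (D₁ : ℂ) ≠ 0 by exact_mod_cast hD₁) (by simpa using congrArg constantCoeff h1)
    · exact ha0 h1
  set Q₂ : ℤ⟦X⟧ := C D₂ * A * Q with hQ₂
  set P₂ : ℤ⟦X⟧ := C D₁ * B * P with hP₂
  have e1 : Q₂.map (Int.castRingHom ℂ) = C (D₂ : ℂ) * (C (D₁ : ℂ) * aC) * Q.map (Int.castRingHom ℂ) := by
    rw [hQ₂, map_mul, map_mul, map_C, eq_intCast, hA]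
  have e2 : P₂.map (Int.castRingHom ℂ) = C (D₁ : ℂ) * (C (D₂ : ℂ) * bC) * P.map (Int.castRingHom ℂ) := by
    rw [hP₂, map_mul, map_mul, map_C, eq_intCast, hB]
  have hwQ : wC * Q₂.map (Int.castRingHom ℂ) = P₂.map (Int.castRingHom ℂ) := by
    rw [e1, e2, ← hzQ]
    linear_combination (C (D₁ : ℂ) * C (D₂ : ℂ) * Q.map (Int.castRingHom ℂ)) * hw
  have hQ₂0 : Q₂ ≠ 0 := by
    rw [hQ₂]
    refine mul_ne_zero (mul_ne_zero ?_ hA0) hQ0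
    intro h0
    have h := congrArg constantCoeff h0
    rw [constantCoeff_C, map_zero] at h
    exact hD₂ h
  -- `z` is rational
  obtain ⟨z, hzmap⟩ := exists_ratSeries_map_eq_of_mul_eq hQ0 hzQ
  have hzq0 : constantCoeff z = 0 := by
    have h0 := hz0
    rw [← hzmap, ← coeff_zero_eq_constantCoeff, coeff_map, coeff_zero_eq_constantCoeff] at h0
    exact (map_eq_zero (algebraMap ℚ ℂ)).mp h0
  have hzs : HasSubst z := HasSubst.of_constantCoeff_zero' hzq0
  have hinj : Function.Injective (PowerSeries.map (algebraMap ℚ ℂ)) := by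
    intro u v huv
    ext n
    have := congrArg (coeff n) huv
    rw [coeff_map, coeff_map] at this
    exact (algebraMap ℚ ℂ).injective this
  have hmm : ∀ φ : ℤ⟦X⟧, (φ.map (Int.castRingHom ℚ)).map (algebraMap ℚ ℂ) = φ.map (Int.castRingHom ℂ) := by
    intro φ; ext n; simp [coeff_map]
  refine ⟨z, P, Q, P₂, Q₂, hzq0, hQ0, ?_, hQ₂0, ?_, ?_⟩
  · apply hinj
    rw [map_mul, hzmap, hmm, hmm]
    exact hzQ
  · apply hinj
    rw [map_mul, powerSeries_map_subst hzs (algebraMap ℚ ℂ), WeierstrassCurve.map_formalW, hmapW, hzmap,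
      hmm, hmm, ← hwC]
    exact hwQ
  · apply hinj
    rw [powerSeries_map_subst hzs (algebraMap ℚ ℂ), Wq.map_formalLog (algebraMap ℚ ℂ), hmapW, hzmap, hlog]
    ext n
    rw [coeff_map, coeff_mk, coeff_mk, map_div₀, map_natCast, eq_ratCast, Rat.cast_intCast, ha]
    rfl

end Summit.BirchSwinnertonDyer.BirchSwinnertonDyer.Theorems.ManinLocalTwoThree.StevensIntegrality

end
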